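import Literature.MathematicalPhysics.QuantumLattice.PropMatrixTruncatedBound
import Literature.MathematicalPhysics.QuantumLattice.FermionicTreeExpansionDetBoundDecay
import Literature.MathematicalPhysics.QuantumLattice.VacuumLinkedCluster
import Literature.MathematicalPhysics.QuantumLattice.OrderedIntegralLimit
import HarnessLib

/-!
# The single-scale bound on the connected vacuum coefficients, uniformly in the volume

Assembly of the determinant-bound tree estimate for chronological free-fermion monomials
(`PropMatrixTruncatedBound.lean`: determinant bound `δ = 2`, uniformly in `β`), its positional sum
(`FermionicTreeExpansionDetBoundDecay.lean`) and the linked-cluster recursion of the vacuum Dyson series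
(`VacuumLinkedCluster.lean`: `k b_k = Σ_{j+m=k} j c_j b_m`). For the connected coefficient

`c_j = ∫_{Δ_j} (-β)^j Σ_{x⃗ ∈ Λ^j} 𝓔ᵀ(n_{x₁↑}n_{x₁↓}(s₁); …; n_{x_j↑}n_{x_j↓}(s_j)) du`,  `s_i = -βu_i`,

of `log Tr e^{-β(dΓ(h) + U Σ_x n_{x↑}n_{x↓})}` (written out with the tree's `ursellOf`,
`FermionicTree.moment`, `vacuumCluster`, `vacuumPropMatrix`, `orderedIntegral`), assume an even,
translation invariant line bound `γ` for the entries of the chronological propagator matrices of the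
vacuum words (sites identified with a finite abelian group `Λ'` by `pos`). Then for `j ≥ 1`

`‖c_j‖ ≤ |Λ'| · β^j/j! · j^{j-2} · 4^j · (8 Σ_z γ z)^{j-1}`     (`norm_vacuumConnectedCoeff_le`):

EXTENSIVE in the volume and GEOMETRIC in `j` up to `j^{j-2}/j! ≤ e^j` — Benfatto–Giuliani–Mastropietro
2006, (2.77) summed over the positions at a single scale (no multiscale decomposition: the radius in `U`
so obtained is `∝ (β Σ_z γ z)⁻¹`, polynomially small in the temperature); de Siqueira Pedra–Salmhofer
2008 for the determinant bound; Brydges 1986 §2 for the combinatorics.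

* `norm_orderedIntegral_le_of_monotone` — `‖∫_{Δ_k(t)} F‖ ≤ B tᵏ/k!` when `‖F‖ ≤ B` on the ordered
  simplex (the factorial that compensates Cayley's `j^{j-2}`);
* `card_fieldsOf_vacuumCluster_singleton` — every vertex of the vacuum word carries two pairs;
* `vacuumPropMatrix_eq_propMatrix_real` — the vacuum propagator matrix at simplex times is a
  chronological `propMatrix` (real antitone times in `[-β, 0]`);
* `sum_norm_vacuumUrsell_le` — `Σ_{x⃗ : x_v = a} |𝓔ᵀ_j(x⃗, s)| ≤ j^{j-2} 4^j (8 Σγ)^{j-1}`;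
* **`norm_vacuumConnectedCoeff_le`** — the displayed bound.

Everything is PROVED; no definition and no named fact.

## References
* G. Benfatto, A. Giuliani, V. Mastropietro, Ann. Henri Poincaré 7 (2006) 809–898, (2.77).
  [cite: BenfattoGiulianiMastropietro2006, (2.77)]
* W. de Siqueira Pedra, M. Salmhofer, Comm. Math. Phys. 282 (2008) 797–818, Thm 2.4.
  [cite: PedraSalmhofer2008, Thm 2.4]
* D. C. Brydges, Les Houches 1984, §2. [cite: Brydges1986, §2]
-/

noncomputable section

open scoped Matrix.Norms.L2Operator ComplexOrder
open Finset MeasureTheory intervalIntegral Set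
open Literature.Probability.LatticeModels (ursellOf)
open Literature.Probability.LatticeModels.BattleFederbush

namespace Literature.MathematicalPhysics.QuantumLattice

/-! ### The simplex volume -/

/-- **`‖∫_{Δ_k(t)} F‖ ≤ B tᵏ/k!`** when `‖F w‖ ≤ B` for the monotone (ordered) `w` with values in
`[0, t]`: the ordered simplex has volume `tᵏ/k!`. [folklore] -/
theorem norm_orderedIntegral_le_of_monotone {E : Type*} [NormedAddCommGroup E] [NormedSpace ℝ E] :
    ∀ (k : ℕ) (F : (Fin k → ℝ) → E) {t B : ℝ}, 0 ≤ t → 0 ≤ B →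
      (∀ w : Fin k → ℝ, Monotone w → (∀ i, w i ∈ Icc 0 t) → ‖F w‖ ≤ B) →
      ‖orderedIntegral k F t‖ ≤ B * t ^ k / k.factorial
  | 0, F, t, B, _, _, h => by
    rw [orderedIntegral_zero, pow_zero, Nat.factorial_zero, Nat.cast_one, div_one, mul_one]
    exact h _ (fun _ _ _ => le_rfl) fun i => i.elim0
  | k + 1, F, t, B, ht, hB, h => by
    rw [orderedIntegral_succ]
    have hG : ∀ u ∈ Set.Ioc (0 : ℝ) t, ‖orderedIntegral k (fun w => F (Fin.snoc w u)) u‖ ≤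
        B * u ^ k / k.factorial := by
      intro u hu
      refine norm_orderedIntegral_le_of_monotone k _ hu.1.le hB fun w hw hwu => h _ ?_ ?_
      · intro a b hab
        refine Fin.lastCases ?_ (fun b' => ?_) b hab
        · intro _
          refine Fin.lastCases ?_ (fun a' => ?_) a
          · simp
          · simp only [Fin.snoc_castSucc, Fin.snoc_last]
            exact (hwu a').2
        · intro hab'
          refine Fin.lastCases ?_ (fun a' => ?_) a hab'
          · intro hlast
            exact absurd (Fin.castSucc_lt_last b') (not_lt.mpr hlast)
          · intro h'
            simp only [Fin.snoc_castSucc]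
            exact hw (Fin.castSucc_le_castSucc_iff.mp h')
      · intro i
        refine Fin.lastCases ?_ (fun i' => ?_) i
        · simp only [Fin.snoc_last]
          exact ⟨hu.1.le, hu.2⟩
        · simp only [Fin.snoc_castSucc]
          exact ⟨(hwu i').1, (hwu i').2.trans hu.2⟩
    calc ‖∫ u in (0 : ℝ)..t, orderedIntegral k (fun w => F (Fin.snoc w u)) u‖
        ≤ ∫ u in (0 : ℝ)..t, B * u ^ k / k.factorial := by
          refine intervalIntegral.norm_integral_le_of_norm_le ht ?_ ?_
          · exact Filter.Eventually.of_forall fun u hu => hG u hu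
          · exact (by fun_prop : Continuous fun u : ℝ => B * u ^ k / (k.factorial : ℝ)).intervalIntegrable
              (μ := volume) _ _
      _ = B * t ^ (k + 1) / (k + 1).factorial := by
          have hfun : (fun u : ℝ => B * u ^ k / k.factorial) = fun u => (B / k.factorial) * u ^ k := by
            funext u; ring
          rw [hfun, intervalIntegral.integral_const_mul, integral_pow, zero_pow (Nat.succ_ne_zero k),
            sub_zero, Nat.factorial_succ]
          push_cast
          have hk : ((k.factorial : ℕ) : ℝ) ≠ 0 := by exact_mod_cast (Nat.factorial_pos k).ne'
          have hk1 : ((k : ℝ) + 1) ≠ 0 := by exact_mod_cast Nat.succ_ne_zero k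
          field_simp

/-! ### The vacuum word: two pairs per vertex, chronological times -/

/-- Every vertex of the vacuum word `∏_i n_{x_i↑}(s_i) n_{x_i↓}(s_i)` carries exactly two pairs.
[folklore] -/
theorem card_fieldsOf_vacuumCluster_singleton (j : ℕ) (x : Fin j) :
    (FermionicTree.fieldsOf (vacuumCluster j) {x}).card = 2 := by
  have hset : FermionicTree.fieldsOf (vacuumCluster j) {x} =
      (univ : Finset (Fin 2)).map ⟨fun r => finProdFinEquiv (x, r), fun r r' hrr' => by
        simpa using congrArg (fun p => (finProdFinEquiv.symm p).2) hrr'⟩ := by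
    ext a
    simp only [FermionicTree.mem_fieldsOf, Finset.mem_singleton, Finset.mem_map, Finset.mem_univ,
      true_and, Function.Embedding.coeFn_mk, vacuumCluster]
    constructor
    · intro ha
      refine ⟨(finProdFinEquiv.symm a).2, ?_⟩
      apply finProdFinEquiv.symm.injective
      rw [Equiv.symm_apply_apply]
      exact Prod.ext ha.symm rfl
    · rintro ⟨r, rfl⟩
      simp
  rw [hset, Finset.card_map, Finset.card_univ, Fintype.card_fin]

variable {Λ : Type*} [LinearOrder Λ] [Fintype Λ] (β : ℝ) (h : Matrix (Orb Λ) (Orb Λ) ℂ)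

/-- **The vacuum propagator matrix at simplex times is a chronological `propMatrix`**: its pair times
are the real numbers `-β v_{⌊p/2⌋}`. [folklore] -/
theorem vacuumPropMatrix_eq_propMatrix_real {j : ℕ} (g : Fin j → Λ) (v : Fin j → ℝ) :
    vacuumPropMatrix β h g (fun i => ((v i : ℝ) : ℂ) * -(β : ℂ)) =
      propMatrix β h (fun p : Fin (j * 2) => orb (g (finProdFinEquiv.symm p).1) (finProdFinEquiv.symm p).2)
        (fun p : Fin (j * 2) => orb (g (finProdFinEquiv.symm p).1) (finProdFinEquiv.symm p).2)
        (fun p : Fin (j * 2) => (((v (finProdFinEquiv.symm p).1 * -β : ℝ)) : ℂ)) := by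
  unfold vacuumPropMatrix
  congr 1
  funext p
  push_cast
  ring

/-- The pair times `-β v_{⌊p/2⌋}` of a monotone `v` with values in `[0, 1]` are antitone and lie in
`[-β, 0]` (for `0 ≤ β`). [folklore] -/
theorem vacuum_times_antitone_window {j : ℕ} {β : ℝ} (hβ : 0 ≤ β) {v : Fin j → ℝ} (hv : Monotone v)
    (hv01 : ∀ i, v i ∈ Icc (0 : ℝ) 1) :
    Antitone (fun p : Fin (j * 2) => v (finProdFinEquiv.symm p).1 * -β) ∧
      ∀ p : Fin (j * 2), -β ≤ v (finProdFinEquiv.symm p).1 * -β ∧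
        v (finProdFinEquiv.symm p).1 * -β ≤ -β + β := by
  constructor
  · intro p q hpq
    have hdiv : (finProdFinEquiv.symm p).1 ≤ (finProdFinEquiv.symm q).1 := by
      rw [Fin.le_def]
      have h1 : ((finProdFinEquiv.symm p).1 : ℕ) = (p : ℕ) / 2 := by simp [finProdFinEquiv, Fin.coe_divNat]
      have h2 : ((finProdFinEquiv.symm q).1 : ℕ) = (q : ℕ) / 2 := by simp [finProdFinEquiv, Fin.coe_divNat]
      rw [h1, h2]
      exact Nat.div_le_div_right hpq
    have := hv hdiv
    show v (finProdFinEquiv.symm q).1 * -β ≤ v (finProdFinEquiv.symm p).1 * -β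
    nlinarith
  · intro p
    have h0 := (hv01 (finProdFinEquiv.symm p).1).1
    have h1 := (hv01 (finProdFinEquiv.symm p).1).2
    constructor <;> nlinarith

/-! ### The positional sum of the vacuum Ursell functions -/

variable {Λ' : Type*} [AddCommGroup Λ'] [Fintype Λ'] [DecidableEq Λ']

/-- **The positional sum of the truncated expectations of the vacuum word, uniformly in `β` and in
the volume**: for Hermitian `h`, `0 ≤ β`, monotone simplex times `v ∈ [0,1]^j`, sites identified with
a finite abelian group `Λ'` by `pos`, and an even translation invariant line bound `γ` on the entries
of the vacuum propagator matrices, for every vertex `v₀` and `a ∈ Λ'`,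
`Σ_{x⃗ : pos x_{v₀} = a} |𝓔ᵀ_j(x⃗, -βv)| ≤ j^{j-2} · 2^{2j} · (8 Σ_z γ z)^{j-1}`
(determinant bound `2`, two pairs per vertex, tree decay). [cite: BenfattoGiulianiMastropietro2006, (2.77)] -/
theorem sum_norm_vacuumUrsell_le (hh : h.IsHermitian) (hβ : 0 ≤ β) (pos : Λ ≃ Λ')
    (γ : Λ' → ℝ) (hγ0 : ∀ z, 0 ≤ γ z) (hγ : ∀ z, γ (-z) = γ z)
    {j : ℕ} (v : Fin j → ℝ) (hvm : Monotone v) (hv01 : ∀ i, v i ∈ Icc (0 : ℝ) 1)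
    (hG : ∀ (g : Fin j → Λ) (f f' : Fin (j * 2)),
      ‖vacuumPropMatrix β h g (fun i => ((v i : ℝ) : ℂ) * -(β : ℂ)) f f'‖ ≤
        γ (pos (g (vacuumCluster j f)) - pos (g (vacuumCluster j f'))))
    (v₀ : Fin j) (a : Λ') :
    ∑ p ∈ univ.filter (fun p : Fin j → Λ' => p v₀ = a),
        ‖ursellOf (FermionicTree.moment (vacuumCluster j)
          (vacuumPropMatrix β h (pos.symm ∘ p) (fun i => ((v i : ℝ) : ℂ) * -(β : ℂ)))) univ‖ ≤
      (j : ℝ) ^ (j - 2) * ((2 : ℝ) ^ (j * 2) * (8 * ∑ z, γ z) ^ (j - 1)) := by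
  have key := FermionicTree.sum_norm_ursellOf_moment_le_of_detBound (𝕜 := ℂ) (vacuumCluster j)
    (fun p : Fin j → Λ' => vacuumPropMatrix β h (pos.symm ∘ p) (fun i => ((v i : ℝ) : ℂ) * -(β : ℂ)))
    (δ := 2) (by norm_num) (fun p => ?_) γ hγ0 hγ (fun p f f' => ?_) 2
    (fun x => (card_fieldsOf_vacuumCluster_singleton j x).le) a (v := v₀)
  · refine key.trans (le_of_eq ?_)
    rw [Fintype.card_fin, Fintype.card_fin]
    norm_num
  · -- the determinant bound `2`, from the chronological structure
    obtain ⟨hanti, hwin⟩ := vacuum_times_antitone_window (j := j) hβ hvm hv01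
    rw [vacuumPropMatrix_eq_propMatrix_real]
    exact propMatrix_weightedMinor_detBound hh β (-β) _ _ _ hanti hwin
  · -- the line bound
    have := hG (pos.symm ∘ p) f f'
    simpa using this

/-! ### The bound on the connected coefficient -/

/-- **The single-scale bound on the connected vacuum coefficient, extensive in the volume**: under the
hypotheses of `sum_norm_vacuumUrsell_le` (for all monotone simplex times), for `j ≥ 1`,
`‖c_j‖ ≤ |Λ'| · (β^j/j!) · j^{j-2} · 2^{2j} · (8 Σ_z γ z)^{j-1}` with
`c_j = ∫_{Δ_j} (-β)^j Σ_{x⃗} 𝓔ᵀ_j(x⃗, -βu) du`. With `j^{j-2}/j! ≤ e^j` this is `|Λ'| (C β Σ_z γ z)^j`-type: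
the series `Σ_j U^j c_j / |Λ'|` converges for `|U| ≲ (β Σ_z γ z)⁻¹`, uniformly in the volume —
Benfatto–Giuliani–Mastropietro 2006, (2.77) at a single scale. [cite: BenfattoGiulianiMastropietro2006, (2.77)] -/
theorem norm_vacuumConnectedCoeff_le (hh : h.IsHermitian) (hβ : 0 ≤ β) (pos : Λ ≃ Λ')
    (γ : Λ' → ℝ) (hγ0 : ∀ z, 0 ≤ γ z) (hγ : ∀ z, γ (-z) = γ z)
    {j : ℕ} (hj : 1 ≤ j)
    (hG : ∀ (v : Fin j → ℝ), Monotone v → (∀ i, v i ∈ Icc (0 : ℝ) 1) →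
      ∀ (g : Fin j → Λ) (f f' : Fin (j * 2)),
        ‖vacuumPropMatrix β h g (fun i => ((v i : ℝ) : ℂ) * -(β : ℂ)) f f'‖ ≤
          γ (pos (g (vacuumCluster j f)) - pos (g (vacuumCluster j f')))) :
    ‖orderedIntegral j (fun v : Fin j → ℝ => (-(β : ℂ)) ^ j * ∑ g : Fin j → Λ,
        ursellOf (FermionicTree.moment (vacuumCluster j)
          (vacuumPropMatrix β h g (fun i => ((v i : ℝ) : ℂ) * -(β : ℂ)))) univ) 1‖ ≤
      (Fintype.card Λ' : ℝ) * (β ^ j / j.factorial) *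
        ((j : ℝ) ^ (j - 2) * ((2 : ℝ) ^ (j * 2) * (8 * ∑ z, γ z) ^ (j - 1))) := by
  classical
  set K : ℝ := (j : ℝ) ^ (j - 2) * ((2 : ℝ) ^ (j * 2) * (8 * ∑ z, γ z) ^ (j - 1)) with hK
  have hγ1 : 0 ≤ ∑ z, γ z := sum_nonneg fun z _ => hγ0 z
  have hK0 : 0 ≤ K := by positivity
  set v₀ : Fin j := ⟨0, hj⟩ with hv₀
  -- pointwise bound on the simplex
  have hpt : ∀ v : Fin j → ℝ, Monotone v → (∀ i, v i ∈ Icc (0 : ℝ) 1) →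
      ‖(-(β : ℂ)) ^ j * ∑ g : Fin j → Λ,
        ursellOf (FermionicTree.moment (vacuumCluster j)
          (vacuumPropMatrix β h g (fun i => ((v i : ℝ) : ℂ) * -(β : ℂ)))) univ‖ ≤
        β ^ j * ((Fintype.card Λ' : ℝ) * K) := by
    intro v hvm hv01
    rw [norm_mul, norm_pow, norm_neg, Complex.norm_real, Real.norm_of_nonneg hβ]
    refine mul_le_mul_of_nonneg_left ?_ (pow_nonneg hβ _)
    -- re-parametrise the sites by the group and split according to the position of `v₀`
    have hre : ∑ g : Fin j → Λ, ‖ursellOf (FermionicTree.moment (vacuumCluster j)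
          (vacuumPropMatrix β h g (fun i => ((v i : ℝ) : ℂ) * -(β : ℂ)))) univ‖ =
        ∑ p : Fin j → Λ', ‖ursellOf (FermionicTree.moment (vacuumCluster j)
          (vacuumPropMatrix β h (pos.symm ∘ p) (fun i => ((v i : ℝ) : ℂ) * -(β : ℂ)))) univ‖ := by
      refine Fintype.sum_equiv ((Equiv.refl (Fin j)).arrowCongr pos) _ _ fun g => ?_
      have hg : pos.symm ∘ ((Equiv.refl (Fin j)).arrowCongr pos g) = g := by
        funext i
        simp [Equiv.arrowCongr]
      rw [hg]
    refine (norm_sum_le _ _).trans ?_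
    rw [hre, ← Finset.sum_fiberwise_of_maps_to (g := fun p : Fin j → Λ' => p v₀) (t := univ)
      (fun p _ => mem_univ _)]
    calc ∑ a ∈ (univ : Finset Λ'), ∑ p ∈ univ.filter (fun p : Fin j → Λ' => p v₀ = a),
          ‖ursellOf (FermionicTree.moment (vacuumCluster j)
            (vacuumPropMatrix β h (pos.symm ∘ p) (fun i => ((v i : ℝ) : ℂ) * -(β : ℂ)))) univ‖
        ≤ ∑ _a ∈ (univ : Finset Λ'), K :=
          sum_le_sum fun a _ => sum_norm_vacuumUrsell_le β h hh hβ pos γ hγ0 hγ v hvm hv01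
            (hG v hvm hv01) v₀ a
      _ = (Fintype.card Λ' : ℝ) * K := by rw [sum_const, card_univ, nsmul_eq_mul]
  calc _ ≤ β ^ j * ((Fintype.card Λ' : ℝ) * K) * 1 ^ j / j.factorial :=
        norm_orderedIntegral_le_of_monotone j _ zero_le_one (by positivity) hpt
    _ = (Fintype.card Λ' : ℝ) * (β ^ j / j.factorial) * K := by rw [one_pow]; ring

end Literature.MathematicalPhysics.QuantumLattice
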